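import Summits.QuantumFields.YangMills.Theorems.ColdStartUniversalityLatticeLangevinGaugeRotation
import Summits.QuantumFields.YangMills.Theorems.ColdStartUniversalityLatticeLangevinFlowItoIntegrals
import Summits.QuantumFields.YangMills.Theorems.ColdStartUniversalityLatticeLangevinCoeffBounds
import Literature.MathematicalPhysics.QuantumFieldTheory.ItoIntegralComplexLinearity
import HarnessLib

/-!
# Route `ColdStartUniversality` (brick «G4(iv-b)», part 2 — the PATHWISE half of gauge covariance in law of the SZZ
# dynamics): a gauge transform of a progressive solution solves the SZZ system driven by the `Ad_h`-rotated flat noise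

Helper file (seat `ym-line-csu-p1`, g11; `--supports stmt-QuantumFields-24810`).  Setting: the SU(2) lattice
Langevin (Shen–Zhu–Zhu) dynamics `latticeLangevinDynamics (fundamentalLatticeRep 2) β'` on `(ℤ/L)³`, a flat driving
noise `W` (independent standard Brownian motions `W^{e,n}`), a lattice gauge transformation `h : Site → SU(2)` acting by
`(h·U)_e = h_x U_e h_{x+eᵢ}⁻¹`, `e = (x, i)`, its `Ad` matrices `R^{(x)}_{mn} = ⟨h_x Eₙ h_xᴴ, E_m⟩` and the rotated noise
`(W^R)^{e,m} = Σₙ R^{(x)}_{mn} W^{e,n}` (file `…GaugeRotation`: flat, same raw natural filtration).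

* ★ `isSolution_gaugeTransform` — if `U` is a solution driven by `W` (raw natural filtration of `W`) which is
  PROGRESSIVELY measurable as a configuration-valued process, then `h·U` is a solution of the SAME system driven by `W^R`
  (w.r.t. the same filtration).  Proof (CSU lead memo g10 §4): the basic Itô integrals `I^{e,n}_{kl} = ∫ (U_e)_{kl} dW^{e,n}`
  exist along a progressive solution (`exists_isItoIntegral_flatCoord`, entries bounded by `1`); by uniqueness and
  linearity of the characterised integral (`IsItoIntegralC.conj_entry_of_martingale`, `.ae_eq`) the solution's own
  integrals are `J^{e,n} = √2 𝐩(Eₙ) I^{e,n}` a.s.; the candidate integrals of `h·U` against `W^R` are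
  `J'^{e,m} = Σₙ R_{mn} (√2 𝐩(E_m) h_x) I^{e,n} h_yᴴ` (`IsItoIntegralC.sum_right_of_martingale`), and
  `Σ_m J'^{e,m} = h_x (Σₙ J^{e,n}) h_yᴴ` by the recombination identity `sum_adCoeff_mul_conj_apply`; the drift integral
  conjugates by `drift_gauge` + `intervalIntegral_conj_entry` (brick G4(iv-a));
* `isSolution_gaugeTransform_flow` — the same for every member `U x` of the regular solution flow
  (`exists_regularFlow`, whose measurability clause is exactly the progressivity used here).

The law-level consequences (`law((h·u)-solution at t) = (h·)_* law(u-solution at t)`, covariance of the transition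
kernels and of `markovTransition`) are packaged in `…GaugeCovarianceLaw`.  THEOREMS ONLY, [folklore] (equivariance of
the gradient-Brownian SDE of a bi-invariant metric under isometries; SZZ §3 Lemma 3.1 for the form of the system);
RECORD-rung R3 plumbing for the K_A2 / TP currencies modulo gauge; no crux or summit is proved; the Yang–Mills mass gap
is NOT proved.
-/

set_option autoImplicit false

noncomputable section

namespace Summit.QuantumFields.YangMills.Theorems.ColdStartUniversality.GaugeCovariance

open MeasureTheory ProbabilityTheory Filter Matrix
open scoped NNReal ENNReal BigOperators
open Literature.Probability.Process Literature.MathematicalPhysics.QuantumFieldTheory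
open Literature.MathematicalPhysics.QuantumLattice (fundamentalRep fundamentalLatticeRep)

/-! ## The pathwise transfer -/

section Transfer

variable {L : ℕ} [NeZero L] {Ω : Type*} {mΩ : MeasurableSpace Ω} {P : Measure Ω}
  {W : ℝ≥0 → Ω → (Edge 3 L × NoiseIdx 2 → ℝ)}

/-- Sections of a jointly measurable map (all σ-algebras through the instances). [folklore] -/
theorem measurable_section {A G Ω' : Type*} [MeasurableSpace A] [MeasurableSpace G] [MeasurableSpace Ω']
    {V : A × (G × Ω') → G} (hV : Measurable V) (x : G) :
    Measurable fun p : A × Ω' => V (p.1, (x, p.2)) :=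
  hV.comp (measurable_fst.prodMk (measurable_const.prodMk measurable_snd))

/-- Entries of `SU(2)` configurations in the fundamental representation: real and imaginary parts are measurable
and bounded by `1`. [folklore] -/
theorem measurable_entry_re_im (e : Edge 3 L) (k l : Fin (fundamentalLatticeRep 2).N) :
    (Measurable fun v : GaugeConfig 3 L (Matrix.specialUnitaryGroup (Fin 2) ℂ) =>
      (((fundamentalLatticeRep 2).ρ (v e)) k l).re) ∧
    (Measurable fun v : GaugeConfig 3 L (Matrix.specialUnitaryGroup (Fin 2) ℂ) =>
      (((fundamentalLatticeRep 2).ρ (v e)) k l).im) ∧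
    ∀ v : GaugeConfig 3 L (Matrix.specialUnitaryGroup (Fin 2) ℂ),
      |(((fundamentalLatticeRep 2).ρ (v e)) k l).re| ≤ 1 ∧ |(((fundamentalLatticeRep 2).ρ (v e)) k l).im| ≤ 1 := by
  haveI := secondCountableTopology_su2
  haveI := borelSpace_config L
  have hc : Continuous fun v : GaugeConfig 3 L (Matrix.specialUnitaryGroup (Fin 2) ℂ) =>
      ((fundamentalLatticeRep 2).ρ (v e)) k l :=
    ((fundamentalLatticeRep 2).continuous.comp (continuous_apply e)).matrix_elem k l
  have hn : ∀ v : GaugeConfig 3 L (Matrix.specialUnitaryGroup (Fin 2) ℂ), ‖((fundamentalLatticeRep 2).ρ (v e)) k l‖ ≤ 1 :=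
    fun v => entry_norm_bound_of_unitary ((fundamentalLatticeRep 2).mem_unitary (v e)) k l
  exact ⟨Complex.measurable_re.comp hc.measurable, Complex.measurable_im.comp hc.measurable, fun v =>
    ⟨(Complex.abs_re_le_norm _).trans (hn v), (Complex.abs_im_le_norm _).trans (hn v)⟩⟩

/-- ★★ **Gauge transform of a progressive solution solves the SZZ system driven by the rotated noise.**  Let `U` be a
solution of the SU(2) lattice Langevin dynamics at coupling `β'` driven by the flat noise `W` (raw natural filtration),
progressively measurable as a configuration-valued process, and `h : Site → SU(2)` a gauge transformation with `Ad`
matrices `R e` (`R e m n = ⟨ρ(h_x)Eₙρ(h_x)ᴴ, E_m⟩`, `e = (x, i)`).  Then `t ↦ h·U_t` is a solution of the SAME system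
driven by the rotated flat noise `(W^R)^{e,m} = Σₙ R e m n · W^{e,n}`, w.r.t. the same filtration. [folklore] -/
theorem isSolution_gaugeTransform [IsProbabilityMeasure P] (β' : ℝ) (hW : IsFlatBrownian W P)
    (h : Literature.MathematicalPhysics.QuantumFieldTheory.Site 3 L → Matrix.specialUnitaryGroup (Fin 2) ℂ)
    (R : Edge 3 L → Matrix (NoiseIdx 2) (NoiseIdx 2) ℝ)
    (hR : ∀ (e : Edge 3 L) (m n : NoiseIdx (fundamentalLatticeRep 2).N), R e m n =
      hsForm (fundamentalLatticeRep 2).N ((fundamentalLatticeRep 2).ρ (h e.1) * noiseDir n *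
        ((fundamentalLatticeRep 2).ρ (h e.1))ᴴ) (noiseDir m))
    {U : ℝ≥0 → Ω → GaugeConfig 3 L (Matrix.specialUnitaryGroup (Fin 2) ℂ)}
    (hU : (latticeLangevinDynamics (fundamentalLatticeRep 2) β').IsSolution (fundamentalRep (Fin 2))
      hW.natFiltration P W U)
    (hprog : ∀ i : ℝ≥0, Measurable[@Prod.instMeasurableSpace (Set.Iic i) Ω inferInstance (hW.natFiltration i)]
      (fun q : Set.Iic i × Ω => U q.1 q.2)) :
    (latticeLangevinDynamics (fundamentalLatticeRep 2) β').IsSolution (fundamentalRep (Fin 2)) hW.natFiltration P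
      (fun t ω (p : Edge 3 L × NoiseIdx 2) => ∑ n : NoiseIdx 2, R p.1 p.2 n * W t ω (p.1, n))
      (fun t ω => gaugeTransform h (U t ω)) := by
  classical
  set r : LatticeRep (Matrix.specialUnitaryGroup (Fin 2) ℂ) := fundamentalLatticeRep 2 with hr
  haveI : Nonempty (Fin r.N) := ⟨(0 : Fin 2)⟩
  haveI : Nonempty (NoiseIdx r.N) := ⟨((0 : Fin 2), (0 : Fin 2), false)⟩
  -- abbreviations with defining equations
  obtain ⟨An, hAn⟩ : ∃ An : NoiseIdx r.N → Matrix (Fin r.N) (Fin r.N) ℂ,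
      An = fun n => (Real.sqrt 2 : ℂ) • r.lieProj (noiseDir n) := ⟨_, rfl⟩
  obtain ⟨A, hA⟩ : ∃ A : Edge 3 L → NoiseIdx r.N → Matrix (Fin r.N) (Fin r.N) ℂ,
      A = fun e m => (Real.sqrt 2 : ℂ) • (r.lieProj (noiseDir m) * r.ρ (h e.1)) := ⟨_, rfl⟩
  obtain ⟨C, hC⟩ : ∃ C : Edge 3 L → Matrix (Fin r.N) (Fin r.N) ℂ, C = fun e => (r.ρ (h (e.1.shift e.2)))ᴴ := ⟨_, rfl⟩
  have hCe : ∀ e : Edge 3 L, C e = (r.ρ (h (e.1.shift e.2)))ᴴ := fun e => by rw [hC]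
  -- progressivity and Borel paths of observables along `U`
  have hsp : ∀ {φ : GaugeConfig 3 L (Matrix.specialUnitaryGroup (Fin 2) ℂ) → ℝ}, Measurable φ →
      IsStronglyProgressive hW.natFiltration (fun t ω => φ (U t ω)) := by
    intro φ hφ i
    exact (hφ.comp (hprog i)).stronglyMeasurable
  have hpath : ∀ {φ : GaugeConfig 3 L (Matrix.specialUnitaryGroup (Fin 2) ℂ) → ℝ}, Measurable φ →
      ∀ ω, Measurable fun s : ℝ => φ (U s.toNNReal ω) := by
    intro φ hφ ω
    exact (measurable_toNNReal_of_isStronglyProgressive (hsp hφ)).comp (measurable_const.prodMk measurable_id)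
  have hpathC : ∀ (e : Edge 3 L) (k l : Fin r.N) (ω : Ω), Measurable fun s : ℝ => (r.ρ (U s.toNNReal ω e)) k l := by
    intro e k l ω
    obtain ⟨hre, him, -⟩ := measurable_entry_re_im (L := L) e k l
    have h1 := hpath hre ω
    have h2 := hpath him ω
    have hdec : (fun s : ℝ => (r.ρ (U s.toNNReal ω e)) k l) = fun s =>
        ((((r.ρ (U s.toNNReal ω e)) k l).re : ℝ) : ℂ) + ((((r.ρ (U s.toNNReal ω e)) k l).im : ℝ) : ℂ) * Complex.I := by
      funext s
      exact (Complex.re_add_im _).symm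
    rw [hdec]
    exact (Complex.measurable_ofReal.comp h1).add ((Complex.measurable_ofReal.comp h2).mul_const _)
  -- the basic integrals `I^{e,n}_{kl} = ∫ (U_e)_{kl} dW^{e,n}`
  have hexI : ∀ (e : Edge 3 L) (n : NoiseIdx r.N) (k l : Fin r.N), ∃ Ic : ℝ≥0 → Ω → ℂ,
      IsItoIntegralC (fun t ω => (r.ρ (U t ω e)) k l) (fun t ω => W t ω (e, n)) Ic hW.natFiltration P ∧
        Martingale (fun t ω => (Ic t ω).re) hW.natFiltration P ∧ Martingale (fun t ω => (Ic t ω).im) hW.natFiltration P := by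
    intro e n k l
    obtain ⟨hre, him, hbd⟩ := measurable_entry_re_im (L := L) e k l
    obtain ⟨Jr, hJr, hJrM, -⟩ := exists_isItoIntegral_flatCoord hW (e, n)
      (H := fun t ω => ((r.ρ (U t ω e)) k l).re) (hsp hre)
      (fun t => sqErr_zero_ne_top_of_bounded (C := 1) (fun s ω => (hbd (U s ω)).1) t)
    obtain ⟨Ji, hJi, hJiM, -⟩ := exists_isItoIntegral_flatCoord hW (e, n)
      (H := fun t ω => ((r.ρ (U t ω e)) k l).im) (hsp him)
      (fun t => sqErr_zero_ne_top_of_bounded (C := 1) (fun s ω => (hbd (U s ω)).2) t)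
    exact ⟨fun t ω => ⟨Jr t ω, Ji t ω⟩, ⟨hJr, hJi⟩, hJrM, hJiM⟩
  choose I hI hIre hIim using hexI
  -- conjugated integrals along `U`: `(B I^{e,n} D)_{ij} = ∫ (B U_e D)_{ij} dW^{e,n}`
  have hK : ∀ (e : Edge 3 L) (n : NoiseIdx r.N) (B D : Matrix (Fin r.N) (Fin r.N) ℂ) (i j : Fin r.N),
      IsItoIntegralC (fun t ω => (B * r.ρ (U t ω e) * D) i j) (fun t ω => W t ω (e, n))
          (fun t ω => (B * (Matrix.of fun k l => I e n k l t ω) * D) i j) hW.natFiltration P ∧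
        Martingale (fun t ω => ((B * (Matrix.of fun k l => I e n k l t ω) * D) i j).re) hW.natFiltration P ∧
        Martingale (fun t ω => ((B * (Matrix.of fun k l => I e n k l t ω) * D) i j).im) hW.natFiltration P :=
    fun e n B D i j => IsItoIntegralC.conj_entry_of_martingale (M := fun t ω => r.ρ (U t ω e))
      (hI e n) (hIre e n) (hIim e n) (hpathC e) B D i j
  -- identification of the solution's own integrals: `J^{e,n} = √2 𝐩(Eₙ) I^{e,n}` a.s.
  obtain ⟨J, hJ, hae⟩ := hU.exists_ito
  have hJI : ∀ (e : Edge 3 L) (n : NoiseIdx r.N) (i j : Fin r.N), ∀ᵐ ω ∂P, ∀ t,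
      J e n i j t ω = (An n * (Matrix.of fun k l => I e n k l t ω) * (1 : Matrix (Fin r.N) (Fin r.N) ℂ)) i j := by
    intro e n i j
    have eN : (fun t ω => (latticeLangevinDynamics r β').noise (matrixConfig r.ρ (U t ω)) e n i j) =
        fun t ω => (An n * r.ρ (U t ω e) * (1 : Matrix (Fin r.N) (Fin r.N) ℂ)) i j := by
      funext t ω
      simp only [latticeLangevinDynamics_noise, matrixConfig, hAn, Matrix.smul_mul, Matrix.mul_one]
    have hJ' : IsItoIntegralC (fun t ω => (latticeLangevinDynamics r β').noise (matrixConfig r.ρ (U t ω)) e n i j)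
        (fun t ω => W t ω (e, n)) (J e n i j) hW.natFiltration P := hJ e n i j
    rw [eN] at hJ'
    exact hJ'.ae_eq (hK e n (An n) 1 i j).1
  have hJI' : ∀ᵐ ω ∂P, ∀ (e : Edge 3 L) (n : NoiseIdx r.N) (i j : Fin r.N) (t : ℝ≥0),
      J e n i j t ω = (An n * (Matrix.of fun k l => I e n k l t ω) * (1 : Matrix (Fin r.N) (Fin r.N) ℂ)) i j :=
    eventually_all.2 fun e => eventually_all.2 fun n => eventually_all.2 fun i => eventually_all.2 fun j => hJI e n i j
  -- the integral equation of `U`, restated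
  have hae' : ∀ᵐ ω ∂P, ∀ (t : ℝ≥0) (e : Edge 3 L) (i j : Fin r.N),
      r.ρ (U t ω e) i j = r.ρ (U 0 ω e) i j +
        (∫ s in (0 : ℝ)..t, (latticeLangevinDynamics r β').drift (matrixConfig r.ρ (U s.toNNReal ω)) e i j) +
        ∑ n : NoiseIdx r.N, J e n i j t ω := hae
  -- the candidate integrals of `h·U`
  refine ⟨fun t => measurable_gaugeTransform_comp h (hU.adapted t), ?_, ?_⟩
  · filter_upwards [hU.continuous] with ω hω using continuous_gaugeTransform_path h hω
  · refine ⟨fun e m i j t ω => ∑ n : NoiseIdx r.N, (R e m n : ℂ) * (A e m * (Matrix.of fun k l => I e n k l t ω) * C e) i j,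
      fun e m i j => ?_, ?_⟩
    · -- the new Itô integrals
      have hsum := IsItoIntegralC.sum_right_of_martingale (s := (Finset.univ : Finset (NoiseIdx r.N)))
        Finset.univ_nonempty (fun n => R e m n) (H := fun t ω => (A e m * r.ρ (U t ω e) * C e) i j)
        (Bf := fun n t ω => W t ω (e, n))
        (Jf := fun n t ω => (A e m * (Matrix.of fun k l => I e n k l t ω) * C e) i j)
        (fun n _ => (hK e n (A e m) (C e) i j).1) (fun n _ => (hK e n (A e m) (C e) i j).2.1)
        (fun n _ => (hK e n (A e m) (C e) i j).2.2)
      have eN : (fun t ω => (latticeLangevinDynamics r β').noise (matrixConfig r.ρ (gaugeTransform h (U t ω))) e m i j) =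
          fun t ω => (A e m * r.ρ (U t ω e) * C e) i j := by
        funext t ω
        rw [matrixConfig_gaugeTransform r h (U t ω)]
        simp only [latticeLangevinDynamics_noise, matrixConfig, hA, hC, Matrix.smul_mul, Matrix.mul_assoc]
      have goal : IsItoIntegralC
          (fun t ω => (latticeLangevinDynamics r β').noise (matrixConfig r.ρ (gaugeTransform h (U t ω))) e m i j)
          (fun t ω => ∑ n : NoiseIdx r.N, R e m n * W t ω (e, n))
          (fun t ω => ∑ n : NoiseIdx r.N, (R e m n : ℂ) * (A e m * (Matrix.of fun k l => I e n k l t ω) * C e) i j)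
          hW.natFiltration P := by
        rw [eN]
        exact hsum
      exact goal
    · -- the a.s. integral identity
      filter_upwards [hae', hJI', hU.continuous] with ω hω hJω hcω
      have key : ∀ (t : ℝ≥0) (e : Edge 3 L) (i j : Fin r.N),
          r.ρ (gaugeTransform h (U t ω) e) i j = r.ρ (gaugeTransform h (U 0 ω) e) i j +
            (∫ s in (0 : ℝ)..t, (latticeLangevinDynamics r β').drift
              (matrixConfig r.ρ (gaugeTransform h (U s.toNNReal ω))) e i j) +
            ∑ m : NoiseIdx r.N, ∑ n : NoiseIdx r.N,
              (R e m n : ℂ) * (A e m * (Matrix.of fun k l => I e n k l t ω) * C e) i j := by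
        intro t e i j
        -- drift part
        have hMc : ∀ k l : Fin r.N, Continuous fun s : ℝ =>
            (latticeLangevinDynamics r β').drift (matrixConfig r.ρ (U s.toNNReal ω)) e k l := by
          intro k l
          have hc : Continuous fun v : GaugeConfig 3 L (Matrix.specialUnitaryGroup (Fin 2) ℂ) =>
              (latticeLangevinDynamics r β').drift (matrixConfig r.ρ v) e := continuous_drift_matrixConfig β' e
          exact (hc.matrix_elem k l).comp (hcω.comp continuous_real_toNNReal)
        have hint : (fun s : ℝ => (latticeLangevinDynamics r β').drift
            (matrixConfig r.ρ (gaugeTransform h (U s.toNNReal ω))) e i j) =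
            fun s => (r.ρ (h e.1) * (latticeLangevinDynamics r β').drift (matrixConfig r.ρ (U s.toNNReal ω)) e * C e) i j := by
          funext s
          rw [matrixConfig_gaugeTransform r h, drift_gauge r h β', hC]
        have hdrift : (∫ s in (0 : ℝ)..t, (latticeLangevinDynamics r β').drift
            (matrixConfig r.ρ (gaugeTransform h (U s.toNNReal ω))) e i j) =
            (r.ρ (h e.1) * (Matrix.of fun k l => ∫ s in (0 : ℝ)..t,
              (latticeLangevinDynamics r β').drift (matrixConfig r.ρ (U s.toNNReal ω)) e k l) * C e) i j := by
          rw [hint]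
          exact intervalIntegral_conj_entry_of_continuous _ _ hMc 0 t i j
        -- matrix form of the integral equation of `U`
        have hmat : r.ρ (U t ω e) = r.ρ (U 0 ω e) +
            (Matrix.of fun k l => ∫ s in (0 : ℝ)..t,
              (latticeLangevinDynamics r β').drift (matrixConfig r.ρ (U s.toNNReal ω)) e k l) +
            ∑ n : NoiseIdx r.N, An n * (Matrix.of fun k l => I e n k l t ω) * (1 : Matrix (Fin r.N) (Fin r.N) ℂ) := by
          ext k l
          rw [Matrix.add_apply, Matrix.add_apply, Matrix.of_apply, Matrix.sum_apply, hω t e k l]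
          congr 1
          exact Finset.sum_congr rfl fun n _ => hJω e n k l t
        rw [rho_gaugeTransform r h (U t ω) e, rho_gaugeTransform r h (U 0 ω) e, ← hCe e, hdrift, hmat, Matrix.mul_add,
          Matrix.mul_add, Matrix.add_mul, Matrix.add_mul, Matrix.add_apply, Matrix.add_apply]
        congr 1
        -- Itô part: `(ρh (Σₙ Aₙ Iₙ 1) C)_{ij} = Σ_m Σₙ R_{mn} (A_m Iₙ C)_{ij}`
        rw [Finset.sum_comm, Finset.mul_sum, Finset.sum_mul, Matrix.sum_apply]
        refine Finset.sum_congr rfl fun n _ => ?_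
        rw [hA, hAn]
        exact (sum_adCoeff_mul_conj_apply r (h e.1) n (R e) (fun m n' => hR e m n') _ (C e) i j).symm
      intro t e i j
      exact key t e i j

/-- ★ **The same for the regular solution flow**: every member `U x` of a solution family with the measurability
clause of `exists_regularFlow` is progressive, so `h·(U x)` solves the system driven by the rotated noise, started at
`h·x`. [folklore] -/
theorem isSolution_gaugeTransform_flow [IsProbabilityMeasure P] (β' : ℝ) (hW : IsFlatBrownian W P)
    (h : Literature.MathematicalPhysics.QuantumFieldTheory.Site 3 L → Matrix.specialUnitaryGroup (Fin 2) ℂ)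
    (R : Edge 3 L → Matrix (NoiseIdx 2) (NoiseIdx 2) ℝ)
    (hR : ∀ (e : Edge 3 L) (m n : NoiseIdx (fundamentalLatticeRep 2).N), R e m n =
      hsForm (fundamentalLatticeRep 2).N ((fundamentalLatticeRep 2).ρ (h e.1) * noiseDir n *
        ((fundamentalLatticeRep 2).ρ (h e.1))ᴴ) (noiseDir m))
    {U : GaugeConfig 3 L (Matrix.specialUnitaryGroup (Fin 2) ℂ) → ℝ≥0 → Ω →
      GaugeConfig 3 L (Matrix.specialUnitaryGroup (Fin 2) ℂ)}
    (hUsol : ∀ x, (∀ ω, U x 0 ω = x) ∧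
      (latticeLangevinDynamics (fundamentalLatticeRep 2) β').IsSolution (fundamentalRep (Fin 2))
        hW.natFiltration P W (U x))
    (hU : ∀ i : ℝ≥0, Measurable[@Prod.instMeasurableSpace (Set.Iic i)
        (GaugeConfig 3 L (Matrix.specialUnitaryGroup (Fin 2) ℂ) × Ω) inferInstance
        (@Prod.instMeasurableSpace (GaugeConfig 3 L (Matrix.specialUnitaryGroup (Fin 2) ℂ)) Ω inferInstance
          (hW.natFiltration i))]
      (fun q : Set.Iic i × (GaugeConfig 3 L (Matrix.specialUnitaryGroup (Fin 2) ℂ) × Ω) => U q.2.1 q.1 q.2.2))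
    (x : GaugeConfig 3 L (Matrix.specialUnitaryGroup (Fin 2) ℂ)) :
    (∀ ω, gaugeTransform h (U x 0 ω) = gaugeTransform h x) ∧
    (latticeLangevinDynamics (fundamentalLatticeRep 2) β').IsSolution (fundamentalRep (Fin 2)) hW.natFiltration P
      (fun t ω (p : Edge 3 L × NoiseIdx 2) => ∑ n : NoiseIdx 2, R p.1 p.2 n * W t ω (p.1, n))
      (fun t ω => gaugeTransform h (U x t ω)) := by
  refine ⟨fun ω => by rw [(hUsol x).1 ω], isSolution_gaugeTransform β' hW h R hR (hUsol x).2 fun i => ?_⟩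
  exact @measurable_section (Set.Iic i) (GaugeConfig 3 L (Matrix.specialUnitaryGroup (Fin 2) ℂ)) Ω
    inferInstance inferInstance (hW.natFiltration i) _ (hU i) x

end Transfer

end Summit.QuantumFields.YangMills.Theorems.ColdStartUniversality.GaugeCovariance

end
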